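import Summits.HodgeConjecture.HodgeConjecture.Theorems.Ring2HypothesesWeilComponentsCMLadderMZ
import Summits.HodgeConjecture.HodgeConjecture.Theorems.Ring2HypothesesWeilTypeCMExact
import Literature.AlgebraicGeometry.Deligne1982.WeilTypeCMHodgeRingHolds
import HarnessLib

/-!
# Ring 2 — hypotheses layer, part XXXIII: the fact-#24 BINDER LEDGER of the hypotheses axis — the T6-CM / T6(δ)-CM rows of parts VII-D, VII-D′ and XV binder-free after the Literature seat's proof of Deligne–Milne endnote 16

HONEST FRAMING: research route conditional on HC_CM; not a corollary; Q11.4-sentence-2 already refuted in dim ≥ 3.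

Cell `pub-hodge-ring2`, seat `pub-hodge-ring2-typer2`, gen 29. `HC_CM` is ALWAYS the binder
`(hCM : Theses.RankFourFaces.CMAbelianHodge)` (stmt-HodgeConjecture-3052), never an axiom, never cited as known.
Nothing here proves a new case of the Hodge conjecture: every row is an implication between NAMED typed statements of
the tree. Sorry-free; axioms `propext`, `Classical.choice`, `Quot.sound`.

## Why this file exists (count once)

Eight theorems of this axis carry the binder `(h24 : Deligne1982_hodgeRing_weilTypeCM_of_hodgeGroupSU)` — fact #24 of
the cell's literature table: the Hodge-RING form of Weil's theorem for the general member of a Weil-type family over a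
CM field `E` (`Hg = SU(φ)` ⟹ `B• ⊆ ⟨D¹, W_E⟩`), which in print is Deligne 1982 §4 (4.4)/Prop. 4.4 for the Hodge-ness of
`W_E` plus, for the ring statement, van Geemen's Thm. 6.12 when `E` is imaginary quadratic and Milne's endnote 16 to the
2003 re-edition ("the same argument works in general") when `[E:ℚ] ≥ 4` — an UNREFEREED endnote, which is why the axis
kept it as a binder. The literature seat has now PROVED the typed statement on the tree's carriers:
`Deligne1982_hodgeRing_weilTypeCM_of_hodgeGroupSU_holds` (`Literature/AlgebraicGeometry/Deligne1982/WeilTypeCMHodgeRingHolds.lean`,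
p214055, 2026-08-20; a reproduction of Weil's invariant-theory argument for every CM field, not a result of the cell).
The Moonen–Zarhin criterion, the other print input of these rows, is a tree theorem since part VII-D′
(`MoonenZarhin1998_weilClasses_hodgeCriterion_holds`). Landed signatures are never edited in place (the paper's
by-name index and every call site would break), so — exactly as for the van Geemen 6.12 binder (part XXXII) and the
Landherr binder (part XXX-C) — each row gets an ADDITIVE twin `<name>_discharged` with the SAME statement minus `h24`
(and minus `hMZ` where part VII-D still carried it); the gen-8…15 theorems stay as they are (each is implied by its twin).

## Ledger (the 8 `h24` rows of the axis ↦ 5 binder-free twins; `P-CM(δ)` = `CMPointedWeilFamiliesComponentCM`,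
`VHC-CM(δ)` = `WeilVariationalHodgeComponentCM` (OPEN, the content), `R∞` = `WeilClassesImaginaryQuadratic`)

| # | twin (this file) | of (part, file) | binders left |
|---|---|---|---|
| 1 | `hodgeGeneralWeilTypeCMField_of_weilClassesWeilTypeCM_discharged` | VII-D T6-CM (`…WeilComponentsCMLadder`), VII-D′ T6-CM′ (`…CMLadderMZ`) | R3⁺ = `WeilClassesWeilTypeCM` |
| 2 | `hodgeGeneralWeilTypeComponentCM_of_weilClassesComponentCM_discharged` | VII-D T6(δ)-CM, VII-D′ T6(δ)-CM′ | `W-CM(δ)` = `WeilClassesComponentCM R e₀ k δ` |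
| 3 | `HC_GeneralWeilTypeComponentCM_of_HC_CM_discharged` | VII-D `hodgeGeneralWeilTypeComponentCM_of_HC_CM`, VII-D′ `HC_GeneralWeilTypeComponentCM_of_HC_CM` | `HC_CM`, `P-CM(δ)`, `VHC-CM(δ)` |
| 4 | `hodgeGeneralWeilTypeComponentCM_of_divisorGeneratedCMPointed_discharged` | VII-D′ T6(δ)-CM without `HC_CM` | divisor-generated `P-CM(δ)`, `VHC-CM(δ)` |
| 5 | `hodgeGeneralWeilTypeEveryCMField_of_quadratic_of_weilClassesWeilTypeCM_discharged` | XV closed ladder row (`…WeilTypeCMExact`) | `R∞`, R3⁺ |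

After this file the LIVE `h24` binders of the hypotheses axis are 0 of 8 (the transport axis keeps its own `h24` rows;
they are that seat's to twin). HONEST COLUMN, unchanged: on every T6(δ)-CM row `HC_CM` is NOMINAL (replaceable by
divisor-generated CM anchors, row 4); the content is the δ-restricted Weil-confined variational statement (OPEN) plus
the pointed-family leaf; rows 1, 2, 5 are implications from ladder rungs that are themselves cases of the summit. WHAT
THE KERNEL ROWS ADD about Hodge classes: NOTHING new — implications between named statements, now with no print binder.
What changed is a STATUS WORD of the hypotheses census: fact #24 NAMED-FACT (unrefereed for `[E:ℚ] ≥ 4`) → TREE-THEOREM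
on the typed carriers (`IsWeilTypeCM`, `HasHodgeGroupSUCM`, `divisorWeilAlgebra`); whether those carriers render the
printed objects faithfully is the statement-fidelity question, audited elsewhere (referee seats), not settled here.

References: [Deligne1982HodgeCycles] P. Deligne, Hodge cycles on abelian varieties, LNM 900 (1982), §4 (4.4), Prop. 4.4,
Lemma 4.6, Thm. 4.8, §5; J. S. Milne's 2003 re-edition, endnote 16; [Weil1977HodgeRing]; [vanGeemen1994HodgeAV] Thm. 6.12
(PDF pp. 231–232); [MoonenZarhin1998WeilClasses] §1 Criterion; [CharlesSchnell2014Notes] Conj. 11.3.1; [Deligne2000] §1.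
-/

noncomputable section

set_option linter.dupNamespace false

open CategoryTheory
open Literature.AlgebraicGeometry Literature.AlgebraicGeometry.Motives
open Literature.AlgebraicGeometry.HodgeTheory
open Literature.AlgebraicGeometry.Deligne1982
open Literature.AlgebraicTopology.SingularHomology
open Summit.HodgeConjecture.HodgeConjecture.WeilTypeLadder
open Summit.HodgeConjecture.HodgeConjecture.Theses
open Summit.HodgeConjecture.HodgeConjecture.Ring2Transport

namespace Summit.HodgeConjecture.HodgeConjecture.Ring2.Hypotheses

/-! ### §1 Row T6-CM: R3⁺ on Deligne's carriers ⟹ the Hodge conjecture for the general member of CM-field Weil type, no binder -/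

/-- **Row 1 — T6-CM, binder-free**: if the rational `(k,k)` Weil classes of every Weil-type CM abelian variety
(`e₀ ≥ 2`) are algebraic, the Hodge conjecture holds for every such variety with Hodge group `SU(φ)`: the rational Weil
classes span `W_E ⊗ ℂ` (theorem), which is of type `(k,k)` (Moonen–Zarhin, theorem), and the Hodge ring of the general
member is `⟨D¹, W_E⟩` (Deligne–Milne endnote 16, now the theorem `Deligne1982_hodgeRing_weilTypeCM_of_hodgeGroupSU_holds`).
Twin of `hodgeGeneralWeilTypeCMField_of_weilClassesWeilTypeCM` (VII-D) and of `…_of_deligne` (VII-D′).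
[cite: Deligne1982HodgeCycles, §4 (4.4), Prop. 4.4 and Milne 2003 re-edition endnote 16] [cite: MoonenZarhin1998WeilClasses, §1 (Criterion)]
[cite: vanGeemen1994HodgeAV, Thm. 6.12] -/
theorem hodgeGeneralWeilTypeCMField_of_weilClassesWeilTypeCM_discharged (h : WeilClassesWeilTypeCM) :
    HodgeGeneralWeilTypeCMField :=
  hodgeGeneralWeilTypeCMField_of_weilClassesWeilTypeCM Deligne1982_hodgeRing_weilTypeCM_of_hodgeGroupSU_holds
    MoonenZarhin1998_weilClasses_hodgeCriterion_holds h

/-! ### §2 Rows T6(δ)-CM: the general member of the CM-field component `(E = ℚ[T]/(R(T²)), e₀, k, δ)`, no print binder -/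

section Component

variable {R : Polynomial ℤ} [Fact (Irreducible (realPolyQ R))] {e₀ k : ℕ} {δ : cmNormResidueGroup R}

/-- **Row 2 — T6(δ)-CM from the component target, binder-free.** Twin of
`hodgeGeneralWeilTypeComponentCM_of_weilClassesComponentCM` (VII-D: `h24`, `hMZ`) and of `…_of_deligne` (VII-D′: `h24`).
[cite: Deligne1982HodgeCycles, §4 (4.4), Prop. 4.4 and Milne 2003 re-edition endnote 16] [cite: MoonenZarhin1998WeilClasses, §1 (Criterion)] -/
theorem hodgeGeneralWeilTypeComponentCM_of_weilClassesComponentCM_discharged (hWδ : WeilClassesComponentCM R e₀ k δ) :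
    HodgeGeneralWeilTypeComponentCM R e₀ k δ :=
  hodgeGeneralWeilTypeComponentCM_of_weilClassesComponentCM Deligne1982_hodgeRing_weilTypeCM_of_hodgeGroupSU_holds
    MoonenZarhin1998_weilClasses_hodgeCriterion_holds hWδ

/-- **Row 3 — `HC_<general member of the CM-field component (E, 2k, δ)>_of_HC_CM`, no print binder**: from `HC_CM`
(BY NAME), the CM-pointed δ-leaf and the δ-restricted Weil-confined variational Hodge statement. CONDITIONAL on the three;
(c7) KIND of `HC_CM`: NOMINAL via W1-CM (row 4 removes it). Twin of `hodgeGeneralWeilTypeComponentCM_of_HC_CM` (VII-D)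
and `HC_GeneralWeilTypeComponentCM_of_HC_CM` (VII-D′).
[cite: Deligne1982HodgeCycles, §4 proof of Thm. 4.8, (4.4) and §5] [cite: CharlesSchnell2014Notes, Conj. 11.3.1] -/
theorem HC_GeneralWeilTypeComponentCM_of_HC_CM_discharged (hCM : Theses.RankFourFaces.CMAbelianHodge)
    (hP : CMPointedWeilFamiliesComponentCM R e₀ k δ) (hV : WeilVariationalHodgeComponentCM R e₀ k δ) :
    HodgeGeneralWeilTypeComponentCM R e₀ k δ :=
  hodgeGeneralWeilTypeComponentCM_of_weilClassesComponentCM_discharged (weilClassesComponentCM_of_HC_CM hCM hP hV)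

/-- **Row 4 — T6(δ)-CM WITHOUT `HC_CM` and without any print binder**: from δ-families pointed at a DIVISOR-GENERATED CM
fibre (row W1′-CM of part VII-C) and the δ-VHC statement. Twin of
`hodgeGeneralWeilTypeComponentCM_of_divisorGeneratedCMPointed` (VII-D′).
[cite: Deligne1982HodgeCycles, §5 and §4 (4.4)] [cite: CharlesSchnell2014Notes, Conj. 11.3.1] -/
theorem hodgeGeneralWeilTypeComponentCM_of_divisorGeneratedCMPointed_discharged
    (hP : DivisorGeneratedCMPointedWeilFamiliesComponentCM R e₀ k δ) (hV : WeilVariationalHodgeComponentCM R e₀ k δ) :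
    HodgeGeneralWeilTypeComponentCM R e₀ k δ :=
  hodgeGeneralWeilTypeComponentCM_of_weilClassesComponentCM_discharged
    (weilClassesComponentCM_of_divisorGeneratedCMPointed hP hV)

end Component

/-! ### §3 The closed ladder row of part XV: `R∞ → R3⁺ → HodgeGeneralWeilTypeEveryCMField`, no print binder -/

/-- **Row 5 — the Hodge conjecture for the GENERAL Weil-type abelian variety over EVERY CM field from the algebraicity
of the rational Weil classes alone** (`R∞` for the imaginary quadratic fields, R3⁺ on Deligne's carriers for
`[E:ℚ] ≥ 4`); no families, no `HC_CM`, and — after the proof of endnote 16 — no print binder. Twin of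
`hodgeGeneralWeilTypeEveryCMField_of_quadratic_of_weilClassesWeilTypeCM` (XV).
[cite: Deligne1982HodgeCycles, §4 (4.4), Prop. 4.4 and Milne 2003 re-edition endnote 16] [cite: MoonenZarhin1998WeilClasses, §1]
[cite: vanGeemen1994HodgeAV, Thm. 6.12] -/
theorem hodgeGeneralWeilTypeEveryCMField_of_quadratic_of_weilClassesWeilTypeCM_discharged
    (hRq : WeilClassesImaginaryQuadratic) (h : WeilClassesWeilTypeCM) : HodgeGeneralWeilTypeEveryCMField :=
  hodgeGeneralWeilTypeEveryCMField_of_quadratic_of_weilClassesWeilTypeCM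
    Deligne1982_hodgeRing_weilTypeCM_of_hodgeGroupSU_holds hRq h

/-! ### §4 The ledger as one conjunction, and the on-path audit -/

/-- **Fact-#24 binder ledger of the hypotheses axis** (one conjunction a referee can quote): the two former print
binders of the T6-CM chain hold as tree theorems, and rows 1–5 hold with no print binder.
[cite: Deligne1982HodgeCycles, §4 (4.4), Prop. 4.4, §5 and Milne 2003 re-edition endnote 16] [cite: MoonenZarhin1998WeilClasses, §1 (Criterion)]
[cite: CharlesSchnell2014Notes, Conj. 11.3.1] -/
theorem fact24_binder_ledger :
    Deligne1982_hodgeRing_weilTypeCM_of_hodgeGroupSU ∧ MoonenZarhin1998_weilClasses_hodgeCriterion ∧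
      (WeilClassesWeilTypeCM → HodgeGeneralWeilTypeCMField) ∧
      (∀ (R : Polynomial ℤ) [Fact (Irreducible (realPolyQ R))] (e₀ k : ℕ) (δ : cmNormResidueGroup R),
        WeilClassesComponentCM R e₀ k δ → HodgeGeneralWeilTypeComponentCM R e₀ k δ) ∧
      (Theses.RankFourFaces.CMAbelianHodge →
        ∀ (R : Polynomial ℤ) [Fact (Irreducible (realPolyQ R))] (e₀ k : ℕ) (δ : cmNormResidueGroup R),
          CMPointedWeilFamiliesComponentCM R e₀ k δ → WeilVariationalHodgeComponentCM R e₀ k δ →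
            HodgeGeneralWeilTypeComponentCM R e₀ k δ) ∧
      (∀ (R : Polynomial ℤ) [Fact (Irreducible (realPolyQ R))] (e₀ k : ℕ) (δ : cmNormResidueGroup R),
        DivisorGeneratedCMPointedWeilFamiliesComponentCM R e₀ k δ → WeilVariationalHodgeComponentCM R e₀ k δ →
          HodgeGeneralWeilTypeComponentCM R e₀ k δ) ∧
      (WeilClassesImaginaryQuadratic → WeilClassesWeilTypeCM → HodgeGeneralWeilTypeEveryCMField) :=
  ⟨Deligne1982_hodgeRing_weilTypeCM_of_hodgeGroupSU_holds, MoonenZarhin1998_weilClasses_hodgeCriterion_holds,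
    hodgeGeneralWeilTypeCMField_of_weilClassesWeilTypeCM_discharged,
    fun _ _ _ _ _ hW ↦ hodgeGeneralWeilTypeComponentCM_of_weilClassesComponentCM_discharged hW,
    fun hCM _ _ _ _ _ hP hV ↦ HC_GeneralWeilTypeComponentCM_of_HC_CM_discharged hCM hP hV,
    fun _ _ _ _ _ hP hV ↦ hodgeGeneralWeilTypeComponentCM_of_divisorGeneratedCMPointed_discharged hP hV,
    hodgeGeneralWeilTypeEveryCMField_of_quadratic_of_weilClassesWeilTypeCM_discharged⟩

/-- ON-PATH, audit: every conclusion and every remaining rung-binder of this file is a case of the summit.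
[cite: Deligne2000, §1] -/
theorem fact24_binder_ledger_of_hodgeConjecture (h : _root_.HodgeConjecture) (R : Polynomial ℤ)
    [Fact (Irreducible (realPolyQ R))] (e₀ k : ℕ) (δ : cmNormResidueGroup R) :
    HodgeGeneralWeilTypeCMField ∧ HodgeGeneralWeilTypeComponentCM R e₀ k δ ∧ HodgeGeneralWeilTypeEveryCMField ∧
      WeilClassesWeilTypeCM ∧ WeilClassesComponentCM R e₀ k δ :=
  ⟨hodgeGeneralWeilTypeCMField_of_hodgeConjecture h, hodgeGeneralWeilTypeComponentCM_of_hodgeConjecture h δ,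
    hodgeGeneralWeilTypeEveryCMField_of_hodgeConjecture h, weilClassesWeilTypeCM_of_hodgeConjecture h,
    weilClassesComponentCM_of_hodgeConjecture h δ⟩

end Summit.HodgeConjecture.HodgeConjecture.Ring2.Hypotheses

end
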